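import Summits.QuantumFields.BalabanUV.Beta.SymCorrectorFaceDiv
import Summits.QuantumFields.BalabanUV.Beta.KernelWardResidual

/-!
# `BalabanUV.Beta.GAN24.PsiSlotDefectOfDivergences` — binder row G-an2-4 ∕ (CONV-C), W-slot, TRANSFER-III (the (α-0) chain at row D1's literal of record (III′)):
# **THE Ψ-DEFECT FILE IN DIVERGENCE-LETTER CURRENCY** — the face part of the symmetrised slot transport `slotPsiS` (d1-formalise-leaf-03's `SymCorrectorFace`:
# `slotPsiS r n T α x = T α x + faceWt r n α x • faceSum n T (blk n x)`) on either source slot of a bi-table is `LocStencil₂` BY THAT SLOT's SINGLE-DIVERGENCE LETTER ROW,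
# and the divergence letter rows SURVIVE the transport — because THE FACE SUM IS THE BLOCK SUM OF THE SLOT DIVERGENCE (`SymCorrectorFaceDiv.faceSum_eq_blockSum_divV`).

NOT IN PRINT; OUR BOOKKEEPING (G-an2-4 crux team (2), leaf prover `b2b-balaban-gan24-formalise-leaf-03`, gen 79).  WHY THIS FILE: the OWNER gan24-p1 g46's NOTE N-1 (journal
l.65048) (Q2) «is the face part of the slot transport NULL or CONTRACTING on the even tower's class?», answered by name (road-P2 g55 M.44 `CombSlotTransportFaceWard` l.65086 — the face
parts are the tower's Ward contact words; leaf-03 W-3 l.65091 — they are the (α-0) chain's divergence LETTERS, block-summed), and the OWNER's W-4 l.65139: «R-2's W-rows L8b′ ∕ L8d ∕ L9 ∕ L10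
are to be READ WITH (1)–(3): twins over the same letter rows + ONE Ψ-defect file in `slotPsiS_of_divLaw` currency (leaf-03's (C-3)∕(C-4)), first refusal the (E) authors (leaf-03 for
the cell files)».  THIS IS THAT Ψ-DEFECT FILE, for the two SOURCE SLOTS (the kernel-leg conjugation `Ψ̂ᵀ ∘ · ∘ Ψ̂` rides with road-P2's M.45 `CombQuarticStepTransport` and is NOT here).
[folklore] finite-sum bookkeeping BY NAME over d1-formalise-leaf-03 g29's face calculus (`faceSum`, `slotPsiS`, `faceWt`, `faceWtSum`, `abs_faceWt_le`, `bondNbhd`, `card_bondNbhd_le`,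
`l1_le_of_mem_bondNbhd`, `faceSum_eq_blockSum_divV`, `blockSitesF`, `card_blockSitesF`), an2's `KernelWard.divV` ∕ `biLoc_add`, an1's `AxialDressing.l1_sub_le_of_blk_eq`,
`KernelWardResidual.abs_gaugeWt_le_one`; 0 `def`, 0 cited facts, 0 `def … : Prop`, 0 sorry.  SIBLINGS, NOT RESTATED: d1-formalise-leaf-03's TT5 `SymCorrectorSockets.locStencil_slotPsiS` ∕
`locStencil₂_slotPsiS_outer` ∕ `_inner` ∕ `locStencil₂_slotPsiS₂` are the SHAPE statements (the transport PRESERVES `LocStencil ∕ LocStencil₂` with the table's OWN constant × `(1 + faceWtSum·(d+1)·2n^{d+1}·e^{…})`);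
here the DEFECT `slotPsiS T − T` is priced by the slot's DIVERGENCE letter instead (the smallness the cell rows need), and the divergence letters of the transported table are tracked.  The letter-row binders are MY g66 `HalfMemberCellOfDivergences.cell_rows_of_divergence_rows`
binders `h₂` (second slot) ∕ `h₁` (first slot) VERBATIM.
HONEST FRAMING (cell contract, verbatim): «discharging `BetaPertH` makes Bałaban's UV stability UNCONDITIONAL — a real constructive-QFT result; it is NOT the continuum limit and NOT the Clay
problem.»  HONEST DEPENDENCY (verbatim): «continuum YM on T⁴ ⇐ BetaPertH ∧ nine spine estimates (0/9 proved); BetaPertH ⇐ (D1) ∧ (D4) ∧ CAP+tail; G-an2-4 gates asym, D1 and NE2/3/4.»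

CONTENTS (generic `d`; blocking `0 < n`; any root `r`; `0 ≤ δ`; `B(Y) := blockSitesF n Y`):
* §1 THE DEFECT — `biLoc_blockSum_of_anchored` (a block sum of a `BiLoc` family anchored inside the block: constant × `n^{d+1}·e^{δ(d+1)n}`);
  **`locStencil₂_slotPsiS_snd_sub_self_of_divergence_row`**: `h₂ : LocStencil₂ (κ u _ p ↦ divV (κ₁ u₁ ↦ Z κ u κ₁ u₁) p) C₂ δ ⟹ LocStencil₂ (κ u κ′ u′ ↦ slotPsiS r n (Z κ u ·) κ′ u′ − Z κ u κ′ u′)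
  (faceWtSum r n · (n^{d+1} · (e^{δ(d+1)n} · C₂))) δ`; **`locStencil₂_slotPsiS_fst_sub_self_of_divergence_row`**: the first slot, from `h₁`, constant `faceWtSum · n^{d+1} · e^{3δ(d+1)n} · C₁`
  (the row is anchored at the divergence point in all three variables — three block diameters).
* §2 THE LETTERS SURVIVE — `divV_slotPsiS` (pointwise: `divV (slotPsiS T) p = divV T p + Σ_μ (faceWt μ (p−e_μ) • faceSum T (blk (p−e_μ)) − faceWt μ p • faceSum T (blk p))`);
  **`locStencil₂_divRow_snd_slotPsiS_snd_of_divergence_row`**: the SECOND-slot letter row of the second-slot-transported table, constant `C₂ + (d+1)·(faceWtSum·n^{d+1}·e^{δ(d+1)n}·C₂)·(e^δ + 1)`;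
  `faceSum_finset_sum` ∕ (private) `faceSum_sub` (linearity siblings of `SymCorrectorRest.faceSum_add ∕ faceSum_smul`), `divV_fst_slotPsiS_snd` (the second-slot transport COMMUTES with the first-slot
  divergence), `biLoc_faceSum_of_anchored` (a face sum of a `BiLoc` family: constant × `(d+1)·2n^{d+1}·e^{δ(d+1)n}`); **`locStencil₂_divRow_fst_slotPsiS_snd_of_divergence_row`**: the FIRST-slot
  letter row of the second-slot-transported table, constant `C₁ + faceWtSum·((d+1)·2n^{d+1}·e^{δ(d+1)n}·C₁)`.
* §3 **`locStencil₂_slotPsiS₂_sub_self_of_divergence_rows`**: the DEFECT OF THE DOUBLE TRANSPORT `𝒯₂ = slotPsiS_fst ∘ slotPsiS_snd` from `h₁ ∧ h₂` (§1 twice, §2's transported `h₁`).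
READING (zero weight): with an2's `CombChartTransportLevel.GcombSh_eq_conj_psiKS_KInvStep` and road-P2 g55's M.45 `T2RecOf_comb_succ_eq_bm_transport`, the (III′) cells `𝒜^{G′}_l y − 𝒜^{K}_l y` of the
OWNER's `CombAffineUnrollProjected` ∕ `CombT2ShapeEvenEnd` are «the (E) dressing-defect cell at root `ctrOff` on `𝒯`-transported tables + the `𝒯`-defect»; this file prices the SLOT part of the
`𝒯`-defect and shows the eight letter rows of MY g66 `HalfMemberCell*OfDivergences` pass through `𝒯` with explicit constants — the cell rows at (III′) are fed by the SAME letter rows as at (E)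
(«days», the OWNER's W-4 (2)).  WHAT THIS IS NOT: NOT the cell rows `hcell ∕ hcelld` at (III′) themselves ((C-6), after road-P2's M.45 lands), NOT the kernel-leg part, NOT one letter row at
the comb data (the campaign's bill, W-4 (3)), NOT a value; the (III′) campaign is NOT asked (an2 W-4 l.64553) — a zero-weight composition typed while idle (R-2 rule); asserts NO value of
Bałaban's tables; NEVER «G-an2-4 closed» as (CONV-C); NOT D1, NOT `BetaPertH`, NOT continuum, NOT Clay.  2026-08-25; no existing file touched.
-/

noncomputable section

open Finset
open scoped BigOperators
open Literature.MathematicalPhysics.QuantumFieldTheory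
open Literature.MathematicalPhysics.QuantumFieldTheory.Balaban1983to89
open Literature.MathematicalPhysics.QuantumFieldTheory.Balaban1983to89.Beta
open B12Sec2to5 (l1 l1_nonneg)
open ExpKernelCalculus (MKer Site BiLoc l1_sub_triangle l1_sub_symm)
open OneStepResolventKernel (Fib biLoc_finset_sum)
open KernelWard (divV)
open AffineAveraging (box)
open AveragingContours (blk)
open BalabanCompositeJets (LocStencil₂)
open BalabanStepW2 (locStencil₂_add')
open StepJetData (biLoc_smul l1_unitVec)
open KernelWard (biLoc_add)
open AxialDressing (l1_sub_le_of_blk_eq)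
open Summit.QuantumFields.BalabanUV.Beta.CompositeCorrectorLocality (blockSitesF)
open Summit.QuantumFields.BalabanUV.Beta.KernelWardRelative (gaugeWt)
open Summit.QuantumFields.BalabanUV.Beta.KernelWardResidual (abs_gaugeWt_le_one)
open Summit.QuantumFields.BalabanUV.Beta.SymCorrectorFace (faceWt faceSum slotPsiS faceWtSum faceWtSum_nonneg abs_faceWt_le card_blockSitesF b6unitVec_eq gaugeWt_eq
  bondNbhd card_bondNbhd_le l1_le_of_mem_bondNbhd)
open Summit.QuantumFields.BalabanUV.Beta.SymCorrectorFaceDiv (faceSum_eq_blockSum_divV blk_eq_of_mem_blockSitesF)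

namespace Summit.QuantumFields.BalabanUV.Beta.GAN24.PsiSlotDefectOfDivergences

variable {d : ℕ} {n : ℕ} (hn : 0 < n) (r : Fin (d + 1) → ℕ)

omit hn in
/-- [folklore] `BiLoc` is monotone in its constant (local copy of the tree's `biLoc_mono`-type lemmas, kept private). -/
private theorem biLoc_le {K : MKer (d + 1) (Fib d)} {p q : Site (d + 1)} {C C' δ : ℝ} (h : BiLoc K p q C δ) (hC : C ≤ C') : BiLoc K p q C' δ :=
  fun x y a b => (h x y a b).trans (mul_le_mul_of_nonneg_right hC (Real.exp_pos _).le)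

include hn

/-- [folklore] **A BLOCK SUM OF A `BiLoc` FAMILY ANCHORED INSIDE THE BLOCK**: if every `K x` (`x ∈ B(blk n u')`) is `BiLoc` at `(u, u)` with constant `C·e^{−δ·l1(x − u)}`
(`0 ≤ C`, `0 ≤ δ`), then `Σ_{x ∈ B(blk n u')} K x` is `BiLoc` at `(u, u)` with constant `n^{d+1}·e^{δ(d+1)n}·C·e^{−δ·l1(u' − u)}` (triangle inequality inside the block,
`AxialDressing.l1_sub_le_of_blk_eq`, `card_blockSitesF`). -/
theorem biLoc_blockSum_of_anchored {K : Site (d + 1) → MKer (d + 1) (Fib d)} {u u' : Site (d + 1)} {C δ : ℝ} (hC : 0 ≤ C) (hδ : 0 ≤ δ)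
    (hK : ∀ x ∈ blockSitesF n (blk n u'), BiLoc (K x) u u (C * Real.exp (-δ * l1 (x - u))) δ) :
    BiLoc (fun p q a b => ∑ x ∈ blockSitesF n (blk n u'), K x p q a b) u u
      (((n : ℝ) ^ (d + 1)) * (Real.exp (δ * (((d : ℝ) + 1) * n)) * C) * Real.exp (-δ * l1 (u' - u))) δ := by
  have hn1 : 1 ≤ n := hn
  have hx : ∀ x ∈ blockSitesF n (blk n u'),
      BiLoc (K x) u u (Real.exp (δ * (((d : ℝ) + 1) * n)) * C * Real.exp (-δ * l1 (u' - u))) δ := by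
    intro x hx
    have hb : blk n x = blk n u' := blk_eq_of_mem_blockSitesF hn hx
    have h1 : l1 (u' - x) ≤ ((d : ℝ) + 1) * n := l1_sub_le_of_blk_eq hn1 hb
    have h2 : l1 (u' - u) ≤ l1 (u' - x) + l1 (x - u) := l1_sub_triangle u' x u
    refine biLoc_le (hK x hx) ?_
    have h3 : -δ * l1 (x - u) ≤ δ * (((d : ℝ) + 1) * n) + -δ * l1 (u' - u) := by nlinarith
    calc C * Real.exp (-δ * l1 (x - u)) ≤ C * Real.exp (δ * (((d : ℝ) + 1) * n) + -δ * l1 (u' - u)) :=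
          mul_le_mul_of_nonneg_left (Real.exp_le_exp.mpr h3) hC
      _ = Real.exp (δ * (((d : ℝ) + 1) * n)) * C * Real.exp (-δ * l1 (u' - u)) := by rw [Real.exp_add]; ring
  have hs := biLoc_finset_sum (blockSitesF n (blk n u')) hx
  rw [Finset.sum_const, card_blockSitesF, nsmul_eq_mul] at hs
  push_cast at hs
  simpa [mul_assoc] using hs

/-- [folklore] **(C-4a), SECOND SLOT: THE FACE DEFECT OF `slotPsiS` ON THE SECOND SOURCE SLOT OF A BI-TABLE IS `LocStencil₂` BY THE SECOND-SLOT DIVERGENCE LETTER**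
(any `Z`, any root `r`, `0 < n`, `0 ≤ δ`): the letter row `h₂ : LocStencil₂ (κ u _ p ↦ divV (κ₁ u₁ ↦ Z κ u κ₁ u₁) p) C₂ δ` (MY g66 FILE 2's binder VERBATIM) gives
`LocStencil₂ (κ u κ' u' ↦ slotPsiS r n (κ₁ u₁ ↦ Z κ u κ₁ u₁) κ' u' − Z κ u κ' u') (faceWtSum r n · (n^{d+1} · (e^{δ(d+1)n} · C₂))) δ`. -/
theorem locStencil₂_slotPsiS_snd_sub_self_of_divergence_row
    (Z : Fin (d + 1) → Site (d + 1) → Fin (d + 1) → Site (d + 1) → MKer (d + 1) (Fib d)) {C₂ δ : ℝ} (hδ : 0 ≤ δ)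
    (h₂ : LocStencil₂ (fun (κ : Fin (d + 1)) (u : Site (d + 1)) (_ : Fin (d + 1)) (p : Site (d + 1)) => divV (fun κ₁ u₁ => Z κ u κ₁ u₁) p) C₂ δ) :
    LocStencil₂ (fun κ u κ' u' => slotPsiS r n (fun κ₁ u₁ => Z κ u κ₁ u₁) κ' u' - Z κ u κ' u')
      (faceWtSum r n * (((n : ℝ) ^ (d + 1)) * (Real.exp (δ * (((d : ℝ) + 1) * n)) * C₂))) δ := by
  intro κ u κ' u'
  have hC₂ : 0 ≤ C₂ := h₂.nonneg
  have e : slotPsiS r n (fun κ₁ u₁ => Z κ u κ₁ u₁) κ' u' - Z κ u κ' u'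
      = faceWt r n κ' u' • fun p q a b => ∑ x ∈ blockSitesF n (blk n u'), divV (fun κ₁ u₁ => Z κ u κ₁ u₁) x p q a b := by
    rw [slotPsiS, add_sub_cancel_left, faceSum_eq_blockSum_divV hn]
    congr 1
    funext p q a b
    simp only [Finset.sum_apply]
  change BiLoc (slotPsiS r n (fun κ₁ u₁ => Z κ u κ₁ u₁) κ' u' - Z κ u κ' u') u u _ δ
  rw [e]
  have hsum := biLoc_blockSum_of_anchored hn (K := fun x => divV (fun κ₁ u₁ => Z κ u κ₁ u₁) x) (u := u) (u' := u') hC₂ hδ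
    (fun x _ => h₂ κ u κ' x)
  refine biLoc_le (biLoc_smul hsum (faceWt r n κ' u')) ?_
  have hw : |faceWt r n κ' u'| ≤ faceWtSum r n := abs_faceWt_le hn r κ' u'
  have hrest : 0 ≤ ((n : ℝ) ^ (d + 1)) * (Real.exp (δ * (((d : ℝ) + 1) * n)) * C₂) * Real.exp (-δ * l1 (u' - u)) := by positivity
  calc |faceWt r n κ' u'| * ((((n : ℝ) ^ (d + 1)) * (Real.exp (δ * (((d : ℝ) + 1) * n)) * C₂)) * Real.exp (-δ * l1 (u' - u)))
        ≤ faceWtSum r n * ((((n : ℝ) ^ (d + 1)) * (Real.exp (δ * (((d : ℝ) + 1) * n)) * C₂)) * Real.exp (-δ * l1 (u' - u))) :=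
        mul_le_mul_of_nonneg_right hw hrest
    _ = faceWtSum r n * (((n : ℝ) ^ (d + 1)) * (Real.exp (δ * (((d : ℝ) + 1) * n)) * C₂)) * Real.exp (-δ * l1 (u' - u)) := by ring

/-- [folklore] **(C-4a), FIRST SLOT: THE FACE DEFECT OF `slotPsiS` ON THE FIRST SOURCE SLOT IS `LocStencil₂` BY THE FIRST-SLOT DIVERGENCE LETTER** — the letter row
`h₁ : LocStencil₂ (_ p κ' u' ↦ divV (κ₁ u₁ ↦ Z κ₁ u₁ κ' u') p) C₁ δ` (MY g66 FILE 2's binder VERBATIM; anchored at the divergence point `p`) gives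
`LocStencil₂ (κ u κ' u' ↦ slotPsiS r n (κ₁ u₁ ↦ Z κ₁ u₁ κ' u') κ u − Z κ u κ' u') (faceWtSum r n · (n^{d+1} · (e^{3δ(d+1)n} · C₁))) δ` (three block diameters: the row is
anchored at the divergence point `x ∈ B(blk n u)` in all three variables, the conclusion at `u`). -/
theorem locStencil₂_slotPsiS_fst_sub_self_of_divergence_row
    (Z : Fin (d + 1) → Site (d + 1) → Fin (d + 1) → Site (d + 1) → MKer (d + 1) (Fib d)) {C₁ δ : ℝ} (hδ : 0 ≤ δ)
    (h₁ : LocStencil₂ (fun (_ : Fin (d + 1)) (p : Site (d + 1)) (κ' : Fin (d + 1)) (u' : Site (d + 1)) => divV (fun κ₁ u₁ => Z κ₁ u₁ κ' u') p) C₁ δ) :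
    LocStencil₂ (fun κ u κ' u' => slotPsiS r n (fun κ₁ u₁ => Z κ₁ u₁ κ' u') κ u - Z κ u κ' u')
      (faceWtSum r n * (((n : ℝ) ^ (d + 1)) * (Real.exp (3 * δ * (((d : ℝ) + 1) * n)) * C₁))) δ := by
  intro κ u κ' u'
  have hn1 : 1 ≤ n := hn
  have hC₁ : 0 ≤ C₁ := h₁.nonneg
  have e : slotPsiS r n (fun κ₁ u₁ => Z κ₁ u₁ κ' u') κ u - Z κ u κ' u'
      = faceWt r n κ u • fun p q a b => ∑ x ∈ blockSitesF n (blk n u), divV (fun κ₁ u₁ => Z κ₁ u₁ κ' u') x p q a b := by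
    rw [slotPsiS, add_sub_cancel_left, faceSum_eq_blockSum_divV hn]
    congr 1
    funext p q a b
    simp only [Finset.sum_apply]
  change BiLoc (slotPsiS r n (fun κ₁ u₁ => Z κ₁ u₁ κ' u') κ u - Z κ u κ' u') u u _ δ
  rw [e]
  -- each summand: the row is anchored at `(x, x)` with constant `C₁·e^{−δ l1(u' − x)}`; re-anchor at `(u, u)` (two block diameters)
  have hx : ∀ x ∈ blockSitesF n (blk n u), BiLoc (divV (fun κ₁ u₁ => Z κ₁ u₁ κ' u') x) u u
      (Real.exp (3 * δ * (((d : ℝ) + 1) * n)) * C₁ * Real.exp (-δ * l1 (u' - u))) δ := by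
    intro x hx
    have hb : blk n x = blk n u := blk_eq_of_mem_blockSitesF hn hx
    have hxu : l1 (u - x) ≤ ((d : ℝ) + 1) * n := l1_sub_le_of_blk_eq hn1 hb
    have hxu' : l1 (x - u) ≤ ((d : ℝ) + 1) * n := by rw [l1_sub_symm]; exact hxu
    have hrow := h₁ κ x κ' u'
    -- `hrow : BiLoc (divV … x) x x (C₁ * exp (-δ * l1 (u' - x))) δ`
    intro p q a b
    have hb1 := hrow p q a b
    have t1 : l1 (p - u) ≤ l1 (p - x) + l1 (x - u) := l1_sub_triangle p x u
    have t2 : l1 (q - u) ≤ l1 (q - x) + l1 (x - u) := l1_sub_triangle q x u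
    have t3 : l1 (u' - u) ≤ l1 (u' - x) + l1 (x - u) := l1_sub_triangle u' x u
    have hcomb : l1 (u' - u) + (l1 (p - u) + l1 (q - u)) ≤ (l1 (u' - x) + (l1 (p - x) + l1 (q - x))) + 3 * (((d : ℝ) + 1) * n) := by
      linarith
    have hexp : C₁ * Real.exp (-δ * l1 (u' - x)) * Real.exp (-δ * (l1 (p - x) + l1 (q - x)))
        ≤ Real.exp (3 * δ * (((d : ℝ) + 1) * n)) * C₁ * Real.exp (-δ * l1 (u' - u)) * Real.exp (-δ * (l1 (p - u) + l1 (q - u))) := by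
      rw [mul_assoc, ← Real.exp_add, mul_assoc, ← Real.exp_add, mul_comm (Real.exp (3 * δ * (((d : ℝ) + 1) * n))) C₁, mul_assoc, ← Real.exp_add]
      refine mul_le_mul_of_nonneg_left (Real.exp_le_exp.mpr ?_) hC₁
      have key : (3 * δ * (((d : ℝ) + 1) * n) + (-δ * l1 (u' - u) + -δ * (l1 (p - u) + l1 (q - u))))
          - (-δ * l1 (u' - x) + -δ * (l1 (p - x) + l1 (q - x)))
          = δ * (((l1 (u' - x) + (l1 (p - x) + l1 (q - x))) + 3 * (((d : ℝ) + 1) * n)) - (l1 (u' - u) + (l1 (p - u) + l1 (q - u)))) := by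
        ring
      have hnn : 0 ≤ δ * (((l1 (u' - x) + (l1 (p - x) + l1 (q - x))) + 3 * (((d : ℝ) + 1) * n)) - (l1 (u' - u) + (l1 (p - u) + l1 (q - u)))) :=
        mul_nonneg hδ (sub_nonneg.mpr hcomb)
      linarith
    exact hb1.trans hexp
  have hs := biLoc_finset_sum (blockSitesF n (blk n u)) hx
  rw [Finset.sum_const, card_blockSitesF, nsmul_eq_mul] at hs
  push_cast at hs
  have hsum : BiLoc (fun p q a b => ∑ x ∈ blockSitesF n (blk n u), divV (fun κ₁ u₁ => Z κ₁ u₁ κ' u') x p q a b) u u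
      (((n : ℝ) ^ (d + 1)) * (Real.exp (3 * δ * (((d : ℝ) + 1) * n)) * C₁) * Real.exp (-δ * l1 (u' - u))) δ := by
    simpa [mul_assoc] using hs
  refine biLoc_le (biLoc_smul hsum (faceWt r n κ u)) ?_
  have hw : |faceWt r n κ u| ≤ faceWtSum r n := abs_faceWt_le hn r κ u
  have hrest : 0 ≤ ((n : ℝ) ^ (d + 1)) * (Real.exp (3 * δ * (((d : ℝ) + 1) * n)) * C₁) * Real.exp (-δ * l1 (u' - u)) := by positivity
  calc |faceWt r n κ u| * ((((n : ℝ) ^ (d + 1)) * (Real.exp (3 * δ * (((d : ℝ) + 1) * n)) * C₁)) * Real.exp (-δ * l1 (u' - u)))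
        ≤ faceWtSum r n * ((((n : ℝ) ^ (d + 1)) * (Real.exp (3 * δ * (((d : ℝ) + 1) * n)) * C₁)) * Real.exp (-δ * l1 (u' - u))) :=
        mul_le_mul_of_nonneg_right hw hrest
    _ = faceWtSum r n * (((n : ℝ) ^ (d + 1)) * (Real.exp (3 * δ * (((d : ℝ) + 1) * n)) * C₁)) * Real.exp (-δ * l1 (u' - u)) := by ring

/-! ## (C-5a) The second-slot divergence letter of a second-slot-transported bi-table -/

omit hn in
/-- [folklore] **THE DIVERGENCE OF A SLOT-TRANSPORTED BOND FAMILY** (module-valued, pointwise): `divV (slotPsiS r n T) p = divV T p + Σ_μ (faceWt μ (p − e_μ) • faceSum n T (blk (p − e_μ))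
− faceWt μ p • faceSum n T (blk p))` — the transported family's divergence is the raw divergence plus a discrete derivative of (face weight × block face sum). -/
theorem divV_slotPsiS (T : Fin (d + 1) → Site (d + 1) → MKer (d + 1) (Fib d)) (p : Site (d + 1)) :
    divV (slotPsiS r n T) p = divV T p + ∑ μ : Fin (d + 1),
      (faceWt r n μ (p - AffineAveraging.unitVec μ) • faceSum n T (blk n (p - AffineAveraging.unitVec μ)) - faceWt r n μ p • faceSum n T (blk n p)) := by
  simp only [divV, b6unitVec_eq, slotPsiS, ← Finset.sum_add_distrib]
  refine Finset.sum_congr rfl fun μ _ => ?_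
  abel

/-- [folklore] **(C-5a): THE SECOND-SLOT DIVERGENCE LETTER SURVIVES THE SECOND-SLOT TRANSPORT, UP TO THE BLOCK-SUMMED LETTER ITSELF** (any `Z`, root `r`, `0 < n`, `0 ≤ δ`):
from `h₂ : LocStencil₂ (κ u _ p ↦ divV (κ₁ u₁ ↦ Z κ u κ₁ u₁) p) C₂ δ`, the same row for the transported table `κ u ↦ slotPsiS r n (Z κ u ·)` holds with constant
`C₂ + (d+1) · (faceWtSum · n^{d+1} · e^{δ(d+1)n} · C₂) · (e^{δ} + 1)` (the two block sums anchored at `p − e_μ` and at `p`). -/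
theorem locStencil₂_divRow_snd_slotPsiS_snd_of_divergence_row
    (Z : Fin (d + 1) → Site (d + 1) → Fin (d + 1) → Site (d + 1) → MKer (d + 1) (Fib d)) {C₂ δ : ℝ} (hδ : 0 ≤ δ)
    (h₂ : LocStencil₂ (fun (κ : Fin (d + 1)) (u : Site (d + 1)) (_ : Fin (d + 1)) (p : Site (d + 1)) => divV (fun κ₁ u₁ => Z κ u κ₁ u₁) p) C₂ δ) :
    LocStencil₂ (fun (κ : Fin (d + 1)) (u : Site (d + 1)) (_ : Fin (d + 1)) (p : Site (d + 1)) =>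
        divV (fun κ₁ u₁ => slotPsiS r n (fun κ₂ u₂ => Z κ u κ₂ u₂) κ₁ u₁) p)
      (C₂ + ((d : ℝ) + 1) * ((faceWtSum r n * (((n : ℝ) ^ (d + 1)) * (Real.exp (δ * (((d : ℝ) + 1) * n)) * C₂))) * (Real.exp δ + 1))) δ := by
  intro κ u κ' p
  have hC₂ : 0 ≤ C₂ := h₂.nonneg
  set A : ℝ := faceWtSum r n * (((n : ℝ) ^ (d + 1)) * (Real.exp (δ * (((d : ℝ) + 1) * n)) * C₂)) with hA
  have hA0 : 0 ≤ A := by rw [hA]; have := faceWtSum_nonneg r n; positivity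
  clear_value A
  -- the block sums, anchored at any site `q`, re-anchored at `u`
  have hblk : ∀ q : Site (d + 1), BiLoc (fun x z a b => ∑ y ∈ blockSitesF n (blk n q), divV (fun κ₁ u₁ => Z κ u κ₁ u₁) y x z a b) u u
      (((n : ℝ) ^ (d + 1)) * (Real.exp (δ * (((d : ℝ) + 1) * n)) * C₂) * Real.exp (-δ * l1 (q - u))) δ := fun q =>
    biLoc_blockSum_of_anchored hn (K := fun y => divV (fun κ₁ u₁ => Z κ u κ₁ u₁) y) hC₂ hδ (fun y _ => h₂ κ u κ' y)
  have hfs : ∀ q : Site (d + 1), faceSum n (fun κ₂ u₂ => Z κ u κ₂ u₂) (blk n q)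
      = fun x z a b => ∑ y ∈ blockSitesF n (blk n q), divV (fun κ₁ u₁ => Z κ u κ₁ u₁) y x z a b := by
    intro q
    rw [faceSum_eq_blockSum_divV hn]
    funext x z a b
    simp only [Finset.sum_apply]
  -- one weighted block sum at `q`: constant `A · e^{−δ l1(q − u)}`
  have hterm : ∀ (μ : Fin (d + 1)) (q : Site (d + 1)),
      BiLoc (faceWt r n μ q • faceSum n (fun κ₂ u₂ => Z κ u κ₂ u₂) (blk n q)) u u (A * Real.exp (-δ * l1 (q - u))) δ := by
    intro μ q
    rw [hfs q]
    refine biLoc_le (biLoc_smul (hblk q) (faceWt r n μ q)) ?_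
    have hw : |faceWt r n μ q| ≤ faceWtSum r n := abs_faceWt_le hn r μ q
    have hrest : 0 ≤ ((n : ℝ) ^ (d + 1)) * (Real.exp (δ * (((d : ℝ) + 1) * n)) * C₂) * Real.exp (-δ * l1 (q - u)) := by positivity
    calc |faceWt r n μ q| * ((((n : ℝ) ^ (d + 1)) * (Real.exp (δ * (((d : ℝ) + 1) * n)) * C₂)) * Real.exp (-δ * l1 (q - u)))
          ≤ faceWtSum r n * ((((n : ℝ) ^ (d + 1)) * (Real.exp (δ * (((d : ℝ) + 1) * n)) * C₂)) * Real.exp (-δ * l1 (q - u))) :=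
          mul_le_mul_of_nonneg_right hw hrest
      _ = A * Real.exp (-δ * l1 (q - u)) := by rw [hA]; ring
  -- the shifted anchor `p − e_μ` costs `e^{δ}`
  have hshift : ∀ μ : Fin (d + 1), A * Real.exp (-δ * l1 (p - AffineAveraging.unitVec μ - u)) ≤ A * Real.exp δ * Real.exp (-δ * l1 (p - u)) := by
    intro μ
    have t : l1 (p - u) ≤ l1 (p - (p - AffineAveraging.unitVec μ)) + l1 (p - AffineAveraging.unitVec μ - u) := l1_sub_triangle p (p - AffineAveraging.unitVec μ) u
    have e1 : l1 (p - (p - AffineAveraging.unitVec μ)) = 1 := by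
      rw [sub_sub_cancel, ← b6unitVec_eq]; exact l1_unitVec μ
    rw [e1] at t
    calc A * Real.exp (-δ * l1 (p - AffineAveraging.unitVec μ - u)) ≤ A * Real.exp (δ + -δ * l1 (p - u)) :=
          mul_le_mul_of_nonneg_left (Real.exp_le_exp.mpr (by nlinarith)) hA0
      _ = A * Real.exp δ * Real.exp (-δ * l1 (p - u)) := by rw [Real.exp_add, mul_assoc]
  have hsum : BiLoc (∑ μ : Fin (d + 1), (faceWt r n μ (p - AffineAveraging.unitVec μ) • faceSum n (fun κ₂ u₂ => Z κ u κ₂ u₂) (blk n (p - AffineAveraging.unitVec μ))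
        - faceWt r n μ p • faceSum n (fun κ₂ u₂ => Z κ u κ₂ u₂) (blk n p))) u u
      (∑ _μ : Fin (d + 1), (A * Real.exp δ * Real.exp (-δ * l1 (p - u)) + A * Real.exp (-δ * l1 (p - u)))) δ := by
    have h := biLoc_finset_sum (Finset.univ : Finset (Fin (d + 1)))
      (K := fun μ => faceWt r n μ (p - AffineAveraging.unitVec μ) • faceSum n (fun κ₂ u₂ => Z κ u κ₂ u₂) (blk n (p - AffineAveraging.unitVec μ))
        - faceWt r n μ p • faceSum n (fun κ₂ u₂ => Z κ u κ₂ u₂) (blk n p))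
      (C := fun _ => A * Real.exp δ * Real.exp (-δ * l1 (p - u)) + A * Real.exp (-δ * l1 (p - u))) (δ := δ) (p := u) (q := u)
      (fun μ _ => by
        have h1 := biLoc_le (hterm μ (p - AffineAveraging.unitVec μ)) (hshift μ)
        have h2 := biLoc_smul (hterm μ p) (-1)
        rw [abs_neg, abs_one, one_mul] at h2
        have h12 := biLoc_add h1 h2
        refine fun x z a b => (le_of_eq ?_).trans (h12 x z a b)
        simp only [Pi.sub_apply, Pi.add_apply, Pi.smul_apply, smul_eq_mul, neg_one_mul, sub_eq_add_neg])
    refine fun x z a b => (le_of_eq ?_).trans (h x z a b)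
    simp only [Finset.sum_apply]
  have hmain := biLoc_add (h₂ κ u κ' p) hsum
  change BiLoc (divV (fun κ₁ u₁ => slotPsiS r n (fun κ₂ u₂ => Z κ u κ₂ u₂) κ₁ u₁) p) u u _ δ
  rw [divV_slotPsiS]
  refine biLoc_le hmain (le_of_eq ?_)
  rw [Finset.sum_const, Finset.card_univ, Fintype.card_fin, nsmul_eq_mul]
  push_cast
  ring

/-! ## (C-5b) The first-slot divergence letter of a second-slot-transported bi-table: the transport and the other slot's divergence commute -/

omit hn in
/-- [folklore] The face sum is additive ∕ commutes with finite sums of families (pointwise in the block). -/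
theorem faceSum_finset_sum {ι : Type*} (s : Finset ι) (F : ι → Fin (d + 1) → Site (d + 1) → MKer (d + 1) (Fib d)) (Y : Site (d + 1)) :
    faceSum n (fun κ u => ∑ i ∈ s, F i κ u) Y = ∑ i ∈ s, faceSum n (F i) Y := by
  simp only [faceSum, Finset.smul_sum]
  rw [Finset.sum_comm]
  refine Finset.sum_congr rfl fun κ' _ => ?_
  rw [Finset.sum_comm]

omit hn in
/-- [folklore] The face sum of a difference of families (private: the public twin is road-P2 g55's `GAN24.CombSlotTransportFaceWard.faceSum_sub'`, landed first). -/
private theorem faceSum_sub (F G : Fin (d + 1) → Site (d + 1) → MKer (d + 1) (Fib d)) (Y : Site (d + 1)) :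
    faceSum n (fun κ u => F κ u - G κ u) Y = faceSum n F Y - faceSum n G Y := by
  simp only [faceSum, smul_sub, Finset.sum_sub_distrib]

omit hn in
/-- [folklore] **THE SECOND-SLOT TRANSPORT COMMUTES WITH THE FIRST-SLOT DIVERGENCE** (pointwise): `divV (κ₁ u₁ ↦ slotPsiS r n (Z κ₁ u₁ ·) κ′ u′) p = divV (κ₁ u₁ ↦ Z κ₁ u₁ κ′ u′) p
+ faceWt r n κ′ u′ • faceSum n (κ₂ u₂ ↦ divV (κ₁ u₁ ↦ Z κ₁ u₁ κ₂ u₂) p) (blk n u′)` — i.e. the first-slot divergence of the transported table is the second-slot transport of the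
first-slot divergence family. -/
theorem divV_fst_slotPsiS_snd (Z : Fin (d + 1) → Site (d + 1) → Fin (d + 1) → Site (d + 1) → MKer (d + 1) (Fib d)) (p : Site (d + 1)) (κ' : Fin (d + 1))
    (u' : Site (d + 1)) :
    divV (fun κ₁ u₁ => slotPsiS r n (fun κ₂ u₂ => Z κ₁ u₁ κ₂ u₂) κ' u') p
      = divV (fun κ₁ u₁ => Z κ₁ u₁ κ' u') p + faceWt r n κ' u' • faceSum n (fun κ₂ u₂ => divV (fun κ₁ u₁ => Z κ₁ u₁ κ₂ u₂) p) (blk n u') := by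
  have e : (fun κ₂ u₂ => divV (fun κ₁ u₁ => Z κ₁ u₁ κ₂ u₂) p)
      = fun κ₂ u₂ => ∑ μ : Fin (d + 1), (Z μ (p - B6BondElimination.unitVec μ) κ₂ u₂ - Z μ p κ₂ u₂) := by
    funext κ₂ u₂; rfl
  rw [e, faceSum_finset_sum]
  simp only [divV, slotPsiS, faceSum_sub, smul_sub, Finset.smul_sum, ← Finset.sum_add_distrib]
  refine Finset.sum_congr rfl fun μ _ => ?_
  abel

/-- [folklore] **A FACE SUM OF A `BiLoc` FAMILY ANCHORED NEAR THE BLOCK**: if every `K κ₂ u₂` (`u₂ ∈ bondNbhd n (blk n u') κ₂`) is `BiLoc` at `(p, p)` with constant `C·e^{−δ·l1(u₂ − p)}`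
(`0 ≤ C`, `0 ≤ δ`), then `faceSum n K (blk n u')` is `BiLoc` at `(p, p)` with constant `(d+1)·(2n^{d+1})·e^{δ(d+1)n}·C·e^{−δ·l1(u' − p)}` (`|gaugeWt| ≤ 1`, `card_bondNbhd_le`,
`l1_le_of_mem_bondNbhd`). -/
theorem biLoc_faceSum_of_anchored {K : Fin (d + 1) → Site (d + 1) → MKer (d + 1) (Fib d)} {p u' : Site (d + 1)} {C δ : ℝ} (hC : 0 ≤ C) (hδ : 0 ≤ δ)
    (hK : ∀ (κ₂ : Fin (d + 1)), ∀ u₂ ∈ bondNbhd n (blk n u') κ₂, BiLoc (K κ₂ u₂) p p (C * Real.exp (-δ * l1 (u₂ - p))) δ) :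
    BiLoc (faceSum n K (blk n u')) p p
      (((d : ℝ) + 1) * ((2 * (n : ℝ) ^ (d + 1)) * (Real.exp (δ * (((d : ℝ) + 1) * n)) * C)) * Real.exp (-δ * l1 (u' - p))) δ := by
  set c : ℝ := Real.exp (δ * (((d : ℝ) + 1) * n)) * C * Real.exp (-δ * l1 (u' - p)) with hc
  have hc0 : 0 ≤ c := by rw [hc]; positivity
  have hterm : ∀ (κ₂ : Fin (d + 1)), ∀ u₂ ∈ bondNbhd n (blk n u') κ₂, BiLoc (gaugeWt n (blk n u') κ₂ u₂ • K κ₂ u₂) p p c δ := by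
    intro κ₂ u₂ hu₂
    have h1 : l1 (u₂ - u') ≤ ((d + 1 : ℕ) : ℝ) * n := l1_le_of_mem_bondNbhd hn hu₂
    push_cast at h1
    have h2 : l1 (u' - p) ≤ l1 (u' - u₂) + l1 (u₂ - p) := l1_sub_triangle u' u₂ p
    rw [l1_sub_symm u' u₂] at h2
    refine biLoc_le (biLoc_smul (hK κ₂ u₂ hu₂) (gaugeWt n (blk n u') κ₂ u₂)) ?_
    have hg : |gaugeWt n (blk n u') κ₂ u₂| ≤ 1 := abs_gaugeWt_le_one n (blk n u') κ₂ u₂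
    have hK0 : 0 ≤ C * Real.exp (-δ * l1 (u₂ - p)) := by positivity
    calc |gaugeWt n (blk n u') κ₂ u₂| * (C * Real.exp (-δ * l1 (u₂ - p))) ≤ 1 * (C * Real.exp (-δ * l1 (u₂ - p))) :=
          mul_le_mul_of_nonneg_right hg hK0
      _ = C * Real.exp (-δ * l1 (u₂ - p)) := one_mul _
      _ ≤ C * Real.exp (δ * (((d : ℝ) + 1) * n) + -δ * l1 (u' - p)) := mul_le_mul_of_nonneg_left (Real.exp_le_exp.mpr (by nlinarith)) hC
      _ = c := by rw [hc, Real.exp_add]; ring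
  have hinner : ∀ κ₂ : Fin (d + 1), BiLoc (fun x z a b => ∑ u₂ ∈ bondNbhd n (blk n u') κ₂, (gaugeWt n (blk n u') κ₂ u₂ • K κ₂ u₂) x z a b) p p
      ((2 * (n : ℝ) ^ (d + 1)) * c) δ := by
    intro κ₂
    have h := biLoc_finset_sum (bondNbhd n (blk n u') κ₂) (fun u₂ hu₂ => hterm κ₂ u₂ hu₂)
    rw [Finset.sum_const, nsmul_eq_mul] at h
    exact biLoc_le h (mul_le_mul_of_nonneg_right (card_bondNbhd_le n (blk n u') κ₂) hc0)
  have houter := biLoc_finset_sum (Finset.univ : Finset (Fin (d + 1))) (fun κ₂ _ => hinner κ₂)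
  rw [Finset.sum_const, Finset.card_univ, Fintype.card_fin, nsmul_eq_mul] at houter
  refine fun x z a b => ((le_of_eq ?_).trans (houter x z a b)).trans (le_of_eq ?_)
  · simp only [faceSum, Finset.sum_apply]
  · rw [hc]; push_cast; ring

/-- [folklore] **(C-5b): THE FIRST-SLOT DIVERGENCE LETTER SURVIVES THE SECOND-SLOT TRANSPORT, UP TO A FACE SUM OF ITSELF** (any `Z`, root `r`, `0 < n`, `0 ≤ δ`): from
`h₁ : LocStencil₂ (_ p κ' u' ↦ divV (κ₁ u₁ ↦ Z κ₁ u₁ κ' u') p) C₁ δ` (MY g66 FILE 2's binder VERBATIM), the same row for the second-slot-transported table holds with constant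
`C₁ + faceWtSum · ((d+1) · (2n^{d+1}) · e^{δ(d+1)n} · C₁)`. -/
theorem locStencil₂_divRow_fst_slotPsiS_snd_of_divergence_row
    (Z : Fin (d + 1) → Site (d + 1) → Fin (d + 1) → Site (d + 1) → MKer (d + 1) (Fib d)) {C₁ δ : ℝ} (hδ : 0 ≤ δ)
    (h₁ : LocStencil₂ (fun (_ : Fin (d + 1)) (p : Site (d + 1)) (κ' : Fin (d + 1)) (u' : Site (d + 1)) => divV (fun κ₁ u₁ => Z κ₁ u₁ κ' u') p) C₁ δ) :
    LocStencil₂ (fun (_ : Fin (d + 1)) (p : Site (d + 1)) (κ' : Fin (d + 1)) (u' : Site (d + 1)) =>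
        divV (fun κ₁ u₁ => slotPsiS r n (fun κ₂ u₂ => Z κ₁ u₁ κ₂ u₂) κ' u') p)
      (C₁ + faceWtSum r n * (((d : ℝ) + 1) * ((2 * (n : ℝ) ^ (d + 1)) * (Real.exp (δ * (((d : ℝ) + 1) * n)) * C₁)))) δ := by
  intro κ p κ' u'
  have hC₁ : 0 ≤ C₁ := h₁.nonneg
  have hface := biLoc_faceSum_of_anchored hn (K := fun κ₂ u₂ => divV (fun κ₁ u₁ => Z κ₁ u₁ κ₂ u₂) p) (p := p) (u' := u') hC₁ hδ
    (fun κ₂ u₂ _ => h₁ κ p κ₂ u₂)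
  have hw : |faceWt r n κ' u'| ≤ faceWtSum r n := abs_faceWt_le hn r κ' u'
  have hsm := biLoc_smul hface (faceWt r n κ' u')
  have hrest : 0 ≤ ((d : ℝ) + 1) * ((2 * (n : ℝ) ^ (d + 1)) * (Real.exp (δ * (((d : ℝ) + 1) * n)) * C₁)) * Real.exp (-δ * l1 (u' - p)) := by positivity
  have hsm' := biLoc_le hsm (mul_le_mul_of_nonneg_right hw hrest)
  have hmain := biLoc_add (h₁ κ p κ' u') hsm'
  change BiLoc (divV (fun κ₁ u₁ => slotPsiS r n (fun κ₂ u₂ => Z κ₁ u₁ κ₂ u₂) κ' u') p) p p _ δ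
  rw [divV_fst_slotPsiS_snd]
  refine biLoc_le hmain (le_of_eq ?_)
  ring

/-! ## §3 The composite slot transport `𝒯₂ := slotPsiS_fst ∘ slotPsiS_snd`: its defect from the two slot letters -/

/-- [folklore] **THE DEFECT OF THE DOUBLE SLOT TRANSPORT IS `LocStencil₂` BY THE TWO SLOT LETTERS** (any `Z`, root `r`, `0 < n`, `0 ≤ δ`): with `X₂ := κ u κ′ u′ ↦ slotPsiS r n (Z κ u ·) κ′ u′`
(second slot transported) and `𝒯₂ Z := κ u κ′ u′ ↦ slotPsiS r n (κ₁ u₁ ↦ X₂ κ₁ u₁ κ′ u′) κ u` (then the first slot), the rows `h₁` `h₂` give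
`LocStencil₂ (𝒯₂ Z − Z) (faceWtSum·n^{d+1}·e^{3δ(d+1)n}·(C₁ + faceWtSum·((d+1)·2n^{d+1}·e^{δ(d+1)n}·C₁)) + faceWtSum·n^{d+1}·e^{δ(d+1)n}·C₂) δ` — §1 (first slot) on `X₂` with §2's transported
`h₁` row, plus §1 (second slot) on `Z`; `𝒯₂ Z − Z = (slotPsiS_fst X₂ − X₂) + (X₂ − Z)`.  This is the SLOT bracket (B2) of the (III′) cell up to the undressed `lin4` (d1-formalise-leaf-03's
`SymCorrectorPair.vertex2OfK_conj_psiKS` transports BOTH bond slots). -/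
theorem locStencil₂_slotPsiS₂_sub_self_of_divergence_rows
    (Z : Fin (d + 1) → Site (d + 1) → Fin (d + 1) → Site (d + 1) → MKer (d + 1) (Fib d)) {C₁ C₂ δ : ℝ} (hδ : 0 ≤ δ)
    (h₁ : LocStencil₂ (fun (_ : Fin (d + 1)) (p : Site (d + 1)) (κ' : Fin (d + 1)) (u' : Site (d + 1)) => divV (fun κ₁ u₁ => Z κ₁ u₁ κ' u') p) C₁ δ)
    (h₂ : LocStencil₂ (fun (κ : Fin (d + 1)) (u : Site (d + 1)) (_ : Fin (d + 1)) (p : Site (d + 1)) => divV (fun κ₁ u₁ => Z κ u κ₁ u₁) p) C₂ δ) :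
    LocStencil₂ (fun κ u κ' u' =>
        slotPsiS r n (fun κ₁ u₁ => slotPsiS r n (fun κ₂ u₂ => Z κ₁ u₁ κ₂ u₂) κ' u') κ u - Z κ u κ' u')
      (faceWtSum r n * (((n : ℝ) ^ (d + 1)) * (Real.exp (3 * δ * (((d : ℝ) + 1) * n))
          * (C₁ + faceWtSum r n * (((d : ℝ) + 1) * ((2 * (n : ℝ) ^ (d + 1)) * (Real.exp (δ * (((d : ℝ) + 1) * n)) * C₁))))))
        + faceWtSum r n * (((n : ℝ) ^ (d + 1)) * (Real.exp (δ * (((d : ℝ) + 1) * n)) * C₂))) δ := by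
  -- the first-slot defect of the second-slot-transported table `X₂`, from its transported `h₁` row (§2)
  have hX₂ := locStencil₂_slotPsiS_fst_sub_self_of_divergence_row hn r
    (fun κ₁ u₁ κ' u' => slotPsiS r n (fun κ₂ u₂ => Z κ₁ u₁ κ₂ u₂) κ' u') hδ
    (locStencil₂_divRow_fst_slotPsiS_snd_of_divergence_row hn r Z hδ h₁)
  -- the second-slot defect of `Z` (§1)
  have hZ := locStencil₂_slotPsiS_snd_sub_self_of_divergence_row hn r Z hδ h₂
  have h := locStencil₂_add' hX₂ hZ
  intro κ u κ' u'
  change BiLoc (slotPsiS r n (fun κ₁ u₁ => slotPsiS r n (fun κ₂ u₂ => Z κ₁ u₁ κ₂ u₂) κ' u') κ u - Z κ u κ' u') u u _ δ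
  rw [(sub_add_sub_cancel (slotPsiS r n (fun κ₁ u₁ => slotPsiS r n (fun κ₂ u₂ => Z κ₁ u₁ κ₂ u₂) κ' u') κ u)
    (slotPsiS r n (fun κ₂ u₂ => Z κ u κ₂ u₂) κ' u') (Z κ u κ' u')).symm]
  exact h κ u κ' u'

end Summit.QuantumFields.BalabanUV.Beta.GAN24.PsiSlotDefectOfDivergences

end
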